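import Mathlib
import HarnessLib
import Summits.NavierStokesRegularity.NavierStokesRegularity.Theorems.UnthreadedRigidityDoorUnthreadedRigidityMixedPairWindowReduction

/-!
# Route `UnthreadedRigidityDoor`, item `UnthreadedRigidity` (W2, stmt-NavierStokesRegularity-27585) — LINE g11-2 «MIXED PAIR»:
# THE QUAD-LAW ALTERNATIVE — the real-analysis half of O2b «EQUATORIAL DICHOTOMY» (file 1 of 2)

Prover file (engine-1 g73; `--supports stmt-NavierStokesRegularity-27585 --as helper`; route-independent imports).

O2b′ (equatorial dichotomy, pressure decay at `t₀` only; section hypothesis `hEq` of `…MixedPairWindowReduction`) says: a classical solution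
issued from a LINKED, EQUATORIAL (`Qa = 0`), NON-COAXIAL admissible pair `u₀ = curl curl((H₁ a·y + H₂ yᵀQy) y)` with profiles analytic on
`(0,∞)` whose threading flux is order-two silent at `t₀` has `H₁` null, or `H₂` null, or HELMHOLTZ-LINKED profiles (`K₁ = cH₁`, `K₂ = 3cH₂`).
The card (CARD §3, §5) splits it into a CHANNEL-2 COMPUTATION («order-two silence gives exactly the QUAD LAW `V′·(H₁H₂ + r(H₁H₂′ − H₁′H₂)) ≡ 0`,
`V = K₁/H₁`») and an ANALYTIC ALTERNATIVE («`V ≡ c` or `rH₂ = c′H₁`; … `c′ = 0`»).  This file PROVES the alternative; file 2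
(`…MixedPairQuadLawPolarised`) certifies the algebra of the quad law on the linked family and discharges the jet dictionary, so that O2b′ rests on
ONE flow-free statement about pair DATA (the equatorial slice law).

* §1 real-analytic bookkeeping on `(0,∞)`: `eqOn_zero_or_of_mul_eq_zero` (a product of two functions analytic on `(0,∞)` that vanishes
  identically has an identically vanishing factor — isolated zeros), `exists_eq_mul_of_wronskian_eq_zero` (`f′g − fg′ ≡ 0`, `g ≢ 0` ⇒ `f = c·g`:
  local constancy of `f/g` off the zeros of `g` + the identity principle), `exists_affine_of_deriv_deriv_eq_zero` (`φ″ ≡ 0 ⇒ φ = A + Br`),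
  `isNullProfile_of_forall_pos` (a smooth-even profile vanishing on `(0,∞)` vanishes at `0`), `tendsto_pow_mul_profile` (`rⁿH(r) → 0` at `0⁺`).
* §2 ★ `quadLaw_alternative` — for virial-admissible `H₁, H₂` analytic on `(0,∞)` and LINKED (`H₁K₂ = 3H₂K₁`), the quad law in
  WRONSKIAN FORM `W₁·D ≡ 0` on `(0,∞)`, `W₁ = K₁′H₁ − K₁H₁′ (= H₁²V′)`, `D = H₁H₂ + r(H₁H₂′ − H₁′H₂) (= H₁²(rH₂/H₁)′)`, forces
  `IsNullProfile H₁ ∨ IsNullProfile H₂ ∨ IsHelmholtzLinked H₁ H₂`.  Proof: `W₁ ≡ 0` or `D ≡ 0` (§1).  If `W₁ ≡ 0`: `K₁ = cH₁`, and linkage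
  `H₁(K₂ − 3cH₂) ≡ 0` with `H₁ ≢ 0` gives `K₂ = 3cH₂`.  If `D ≡ 0`: `D` is the Wronskian of `rH₂` and `H₁`, so `rH₂ = c′H₁`; `c′ = 0` makes `H₂`
  null; for `c′ ≠ 0` the card's «order-of-vanishing bookkeeping at `0`» is NOT available (flat smooth-even profiles `h(s) = √s·e^{−1/s}` defeat
  it) and is REPLACED by linkage (`profile_eq_zero_of_proportional_of_linked`): substituting `H₁ = rH₂/c′` into `H₁K₂ = 3H₂K₁` gives
  `H₂·(r²H₂″ + 6rH₂′ + 6H₂) ≡ 0`, i.e. `(r³H₂)″ ≡ 0` off the zeros of `H₂`, so `r³H₂ = A + Br` on `(0,∞)`, and `rⁿH₂(r) → 0` at `0⁺` forces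
  `A = B = 0`, `H₂ ≡ 0`.

HONEST LABEL: real analysis of radial profiles for one RUNG line about SPECIAL two-shell data; the equatorial slice law (the channel-2
computation of the pair's second jet), O2a′ and S-H′(c<0) remain OPEN; `UnthreadedRigidity` (27585), W2 and NS regularity remain OPEN;
nothing here is a statement about Navier–Stokes regularity.  0 kit.
-/

noncomputable section

-- the summit and its single sub-problem share the name (CONVENTIONS §1), as in every Theorems file
set_option linter.dupNamespace false

namespace Summit.NavierStokesRegularity.NavierStokesRegularity.Theorems.UnthreadedRigidity.MixedPair

open scoped Topology InnerProductSpace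
open Filter Set MeasureTheory Function
open Literature.Analysis.FluidPDE
open Summit.NavierStokesRegularity.NavierStokesRegularity.Theorems.UnthreadedRigidity.ProfileHorn (E3 threadingFlux IsSliceAxisymmetric)
open Summit.NavierStokesRegularity.NavierStokesRegularity.Theorems.UnthreadedRigidity.VirialHorn (e det3 vortAmpL VirialAdmissible sepShellL)
open Summit.NavierStokesRegularity.NavierStokesRegularity.Theorems.UnthreadedRigidity.ThreadingJets (fluxJetTwo analyticOnNhd_vortAmpL
  iteratedDerivWithin_two_threadingFlux_Ici_eq_fluxJetTwo laplacian_pressure_eq_Ico)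

/-! ### §1 Real-analytic bookkeeping on `(0,∞)` -/

section Analytic

variable {f g : ℝ → ℝ}

/-- A function analytic on `(0,∞)` that vanishes near one point of `(0,∞)` vanishes on `(0,∞)` (identity principle). [folklore] -/
theorem eqOn_zero_of_eventuallyEq_zero (hf : AnalyticOnNhd ℝ f (Ioi 0)) {r₀ : ℝ} (hr₀ : 0 < r₀) (h : f =ᶠ[𝓝 r₀] 0) :
    ∀ r : ℝ, 0 < r → f r = 0 := fun _ hr =>
  hf.eqOn_zero_of_preconnected_of_eventuallyEq_zero (convex_Ioi (0 : ℝ)).isPreconnected hr₀ h hr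

/-- ISOLATED ZEROS FOR A PRODUCT: if `f·g ≡ 0` on `(0,∞)` with `f, g` analytic there, then `f ≡ 0` or `g ≡ 0` on `(0,∞)`. [folklore] -/
theorem eqOn_zero_or_of_mul_eq_zero (hf : AnalyticOnNhd ℝ f (Ioi 0)) (hg : AnalyticOnNhd ℝ g (Ioi 0))
    (h : ∀ r : ℝ, 0 < r → f r * g r = 0) :
    (∀ r : ℝ, 0 < r → f r = 0) ∨ (∀ r : ℝ, 0 < r → g r = 0) := by
  by_cases hf0 : ∀ r : ℝ, 0 < r → f r = 0
  · exact Or.inl hf0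
  right
  push Not at hf0
  obtain ⟨r₀, hr₀, hfr₀⟩ := hf0
  have hne : ∀ᶠ s in 𝓝 r₀, f s ≠ 0 := (hf r₀ hr₀).continuousAt.eventually_ne hfr₀
  have hev : g =ᶠ[𝓝 r₀] 0 := by
    filter_upwards [hne, Ioi_mem_nhds hr₀] with s hs hs0
    have := h s hs0
    rcases mul_eq_zero.1 this with h1 | h1
    · exact absurd h1 hs
    · exact h1
  exact eqOn_zero_of_eventuallyEq_zero hg hr₀ hev

/-- ZERO WRONSKIAN ⇒ PROPORTIONAL: for `f, g` analytic on `(0,∞)` with `f′g − fg′ ≡ 0` and `g ≢ 0` there is a constant `c` with `f = c·g`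
on `(0,∞)` (`f/g` is locally constant off the zeros of `g`; identity principle). [folklore] -/
theorem exists_eq_mul_of_wronskian_eq_zero (hf : AnalyticOnNhd ℝ f (Ioi 0)) (hg : AnalyticOnNhd ℝ g (Ioi 0))
    (hW : ∀ r : ℝ, 0 < r → deriv f r * g r - f r * deriv g r = 0) (hg0 : ¬ ∀ r : ℝ, 0 < r → g r = 0) :
    ∃ c : ℝ, ∀ r : ℝ, 0 < r → f r = c * g r := by
  push Not at hg0
  obtain ⟨r₀, hr₀, hgr₀⟩ := hg0
  -- a ball about `r₀` inside `(0,∞)` on which `g ≠ 0`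
  have hne : ∀ᶠ s in 𝓝 r₀, g s ≠ 0 ∧ 0 < s :=
    ((hg r₀ hr₀).continuousAt.eventually_ne hgr₀).and (Ioi_mem_nhds hr₀)
  obtain ⟨ε, hε, hball⟩ := Metric.eventually_nhds_iff_ball.1 hne
  refine ⟨f r₀ / g r₀, ?_⟩
  -- `q = f/g` has zero derivative on the ball, hence is constant there
  have hq : ∀ s ∈ Metric.ball r₀ ε, HasDerivAt (fun t => f t / g t) 0 s := by
    intro s hs
    obtain ⟨hgs, hs0⟩ := hball s hs
    have h1 := ((hf s hs0).differentiableAt.hasDerivAt).div ((hg s hs0).differentiableAt.hasDerivAt) hgs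
    have h2 : (deriv f s * g s - f s * deriv g s) / g s ^ 2 = 0 := by rw [hW s hs0, zero_div]
    rwa [h2] at h1
  have hqd : DifferentiableOn ℝ (fun t => f t / g t) (Metric.ball r₀ ε) := fun s hs =>
    (hq s hs).differentiableAt.differentiableWithinAt
  have hconst : ∀ s ∈ Metric.ball r₀ ε, f s / g s = f r₀ / g r₀ := fun s hs =>
    Metric.isOpen_ball.is_const_of_deriv_eq_zero (convex_ball r₀ ε).isPreconnected hqd
      (fun t ht => (hq t ht).deriv) hs (Metric.mem_ball_self hε)
  -- so `f − c g` vanishes on the ball, hence on `(0,∞)`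
  have han : AnalyticOnNhd ℝ (fun t => f t - f r₀ / g r₀ * g t) (Ioi 0) := fun s hs =>
    (hf s hs).sub (analyticAt_const.mul (hg s hs))
  have hev : (fun t => f t - f r₀ / g r₀ * g t) =ᶠ[𝓝 r₀] 0 := by
    filter_upwards [Metric.ball_mem_nhds r₀ hε] with s hs
    obtain ⟨hgs, -⟩ := hball s hs
    have := hconst s hs
    rw [div_eq_iff hgs] at this
    simp only [Pi.zero_apply]
    rw [this]; ring
  intro r hr
  have := eqOn_zero_of_eventuallyEq_zero han hr₀ hev r hr
  linarith

/-- `φ″ ≡ 0` on `(0,∞)` ⇒ `φ` is affine there. [folklore] -/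
theorem exists_affine_of_deriv_deriv_eq_zero {φ : ℝ → ℝ} (hφ : ∀ r : ℝ, 0 < r → DifferentiableAt ℝ φ r)
    (hφ' : ∀ r : ℝ, 0 < r → DifferentiableAt ℝ (deriv φ) r) (h : ∀ r : ℝ, 0 < r → deriv (deriv φ) r = 0) :
    ∃ A B : ℝ, ∀ r : ℝ, 0 < r → φ r = A + B * r := by
  have hpre : IsPreconnected (Ioi (0 : ℝ)) := (convex_Ioi (0 : ℝ)).isPreconnected
  -- `φ′` is constant
  have h1 : ∀ r : ℝ, 0 < r → deriv φ r = deriv φ 1 := fun r hr =>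
    isOpen_Ioi.is_const_of_deriv_eq_zero hpre (fun s hs => (hφ' s hs).differentiableWithinAt)
      (fun s hs => h s hs) hr (mem_Ioi.2 one_pos)
  -- `φ − B r` is constant
  have h2d : ∀ r : ℝ, 0 < r → HasDerivAt (fun t => φ t - deriv φ 1 * t) 0 r := fun r hr => by
    have h3 : HasDerivAt (fun t => φ t - deriv φ 1 * t) (deriv φ r - deriv φ 1 * 1) r :=
      ((hφ r hr).hasDerivAt).sub ((hasDerivAt_id r).const_mul (deriv φ 1))
    rw [h1 r hr, mul_one, sub_self] at h3
    exact h3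
  have h2 : ∀ r : ℝ, 0 < r → φ r - deriv φ 1 * r = φ 1 - deriv φ 1 * 1 := fun r hr =>
    isOpen_Ioi.is_const_of_deriv_eq_zero hpre (fun s hs => (h2d s hs).differentiableAt.differentiableWithinAt)
      (fun s hs => (h2d s hs).deriv) hr (mem_Ioi.2 one_pos)
  exact ⟨φ 1 - deriv φ 1 * 1, deriv φ 1, fun r hr => by linarith [h2 r hr]⟩

/-- A smooth-even profile (`H(r) = h(r²)`, `h` continuous) that vanishes on `(0,∞)` is a NULL PROFILE (vanishes on `[0,∞)`). [folklore] -/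
theorem isNullProfile_of_forall_pos {l : ℕ} {H : ℝ → ℝ} (hH : VirialAdmissible l H) (h0 : ∀ r : ℝ, 0 < r → H r = 0) :
    IsNullProfile H := by
  obtain ⟨h, hh, hHh⟩ := hH.1
  intro r hr
  rcases hr.lt_or_eq with hr | hr
  · exact h0 r hr
  -- `r = 0`: `h 0` is the limit of `h(s²) = H s = 0` as `s → 0⁺`
  subst hr
  rw [hHh 0 le_rfl]
  have hc : Tendsto (fun s : ℝ => h (s ^ 2)) (𝓝[>] (0 : ℝ)) (𝓝 (h ((0 : ℝ) ^ 2))) :=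
    ((hh.continuous.comp (continuous_id.pow 2)).continuousAt.tendsto).mono_left nhdsWithin_le_nhds
  have hz : Tendsto (fun s : ℝ => h (s ^ 2)) (𝓝[>] (0 : ℝ)) (𝓝 0) := by
    refine tendsto_const_nhds.congr' ?_
    filter_upwards [self_mem_nhdsWithin] with s hs
    rw [← hHh s (le_of_lt hs), h0 s hs]
  have := tendsto_nhds_unique hc hz
  simpa using this

/-- A smooth-even profile is bounded at `0⁺` in the form needed below: `r^n · H(r) → 0` as `r → 0⁺` for `n ≥ 1`. [folklore] -/
theorem tendsto_pow_mul_profile {l : ℕ} {H : ℝ → ℝ} (hH : VirialAdmissible l H) {n : ℕ} (hn : 1 ≤ n) :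
    Tendsto (fun r : ℝ => r ^ n * H r) (𝓝[>] (0 : ℝ)) (𝓝 0) := by
  obtain ⟨h, hh, hHh⟩ := hH.1
  have hc : Continuous fun r : ℝ => r ^ n * h (r ^ 2) := (continuous_id.pow n).mul (hh.continuous.comp (continuous_id.pow 2))
  have ht : Tendsto (fun r : ℝ => r ^ n * h (r ^ 2)) (𝓝[>] (0 : ℝ)) (𝓝 0) := by
    have := (hc.continuousAt (x := 0)).tendsto.mono_left (nhdsWithin_le_nhds (s := Ioi (0 : ℝ)))
    simpa [zero_pow (by omega : n ≠ 0)] using this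
  refine ht.congr' ?_
  filter_upwards [self_mem_nhdsWithin] with s hs
  rw [hHh s (le_of_lt hs)]

end Analytic

/-! ### §2 The quad-law alternative -/

section Alternative

variable {H₁ H₂ : ℝ → ℝ}

/-- derivatives of functions that agree on `(0,∞)` agree on `(0,∞)`. [folklore] -/
theorem deriv_eq_of_forall_pos {F G : ℝ → ℝ} (h : ∀ t : ℝ, 0 < t → F t = G t) {r : ℝ} (hr : 0 < r) :
    deriv F r = deriv G r :=
  Filter.EventuallyEq.deriv_eq (by filter_upwards [Ioi_mem_nhds hr] with t ht using h t ht)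

/-- `(t·H₂)′ = H₂ + tH₂′` on `(0,∞)`. [folklore] -/
theorem deriv_id_mul_profile (hA₂ : AnalyticOnNhd ℝ H₂ (Ioi 0)) {r : ℝ} (hr : 0 < r) :
    deriv (fun t : ℝ => t * H₂ t) r = H₂ r + r * deriv H₂ r := by
  have h : HasDerivAt (fun t : ℝ => t * H₂ t) (1 * H₂ r + r * deriv H₂ r) r :=
    (hasDerivAt_id' r).mul (hA₂ r hr).differentiableAt.hasDerivAt
  rw [h.deriv]; ring

/-- The case `rH₂ = c′H₁`, `c′ ≠ 0` of the alternative is EMPTY: linkage then forces `H₂·(r³H₂)″ ≡ 0`, so a virial-admissible `H₂`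
analytic on `(0,∞)` vanishes on `(0,∞)`.  (This replaces the card's parity bookkeeping at `0`, which flat profiles defeat.) [folklore] -/
theorem profile_eq_zero_of_proportional_of_linked (hV₂ : VirialAdmissible 2 H₂)
    (hA₂ : AnalyticOnNhd ℝ H₂ (Ioi 0)) (hlink : IsLinked H₁ H₂)
    {c' : ℝ} (hc0 : c' ≠ 0) (hc' : ∀ r : ℝ, 0 < r → r * H₂ r = c' * H₁ r) :
    ∀ r : ℝ, 0 < r → H₂ r = 0 := by
  -- `H₁ = rH₂/c′` and its first two derivatives on `(0,∞)`
  have hHG : ∀ t : ℝ, 0 < t → H₁ t = t * H₂ t / c' := fun t ht => by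
    rw [eq_div_iff hc0, mul_comm, ← hc' t ht]
  have hd₂ : ∀ t : ℝ, 0 < t → HasDerivAt H₂ (deriv H₂ t) t := fun t ht => (hA₂ t ht).differentiableAt.hasDerivAt
  have hd₂' : ∀ t : ℝ, 0 < t → HasDerivAt (deriv H₂) (deriv (deriv H₂) t) t := fun t ht =>
    (hA₂.deriv t ht).differentiableAt.hasDerivAt
  have hH₁' : ∀ t : ℝ, 0 < t → deriv H₁ t = (H₂ t + t * deriv H₂ t) / c' := fun t ht => by
    have h : HasDerivAt (fun s : ℝ => s * H₂ s / c') ((1 * H₂ t + t * deriv H₂ t) / c') t :=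
      ((hasDerivAt_id' t).mul (hd₂ t ht)).div_const c'
    rw [deriv_eq_of_forall_pos hHG ht, h.deriv]; ring
  have hH₁'' : ∀ t : ℝ, 0 < t → deriv (deriv H₁) t = (2 * deriv H₂ t + t * deriv (deriv H₂) t) / c' := fun t ht => by
    have h : HasDerivAt (fun s : ℝ => (H₂ s + s * deriv H₂ s) / c')
        ((deriv H₂ t + (1 * deriv H₂ t + t * deriv (deriv H₂) t)) / c') t :=
      ((hd₂ t ht).add ((hasDerivAt_id' t).mul (hd₂' t ht))).div_const c'
    rw [deriv_eq_of_forall_pos hH₁' ht, h.deriv]; ring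
  -- linkage ⇒ `H₂ · (r²H₂″ + 6rH₂′ + 6H₂) ≡ 0`
  have key : ∀ r : ℝ, 0 < r → H₂ r * (r ^ 2 * deriv (deriv H₂) r + 6 * r * deriv H₂ r + 6 * H₂ r) = 0 := by
    intro r hr
    have hr0 : r ≠ 0 := hr.ne'
    have hl := hlink r hr
    simp only [vortAmpL] at hl
    rw [hHG r hr, hH₁' r hr, hH₁'' r hr] at hl
    push_cast at hl
    linear_combination (norm := skip) (-(c' * r / 2)) * hl
    field_simp
    ring
  have hEa : AnalyticOnNhd ℝ (fun r : ℝ => r ^ 2 * deriv (deriv H₂) r + 6 * r * deriv H₂ r + 6 * H₂ r) (Ioi 0) :=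
    fun r hr => (((analyticAt_id.pow 2).mul (hA₂.deriv.deriv r hr)).add
      ((analyticAt_const.mul analyticAt_id).mul (hA₂.deriv r hr))).add (analyticAt_const.mul (hA₂ r hr))
  rcases eqOn_zero_or_of_mul_eq_zero hA₂ hEa key with h | hE
  · exact h
  -- `(r³H₂)″ = r·(r²H₂″ + 6rH₂′ + 6H₂) = 0`
  have hp3 : ∀ t : ℝ, HasDerivAt (fun s : ℝ => s ^ 3) (3 * t ^ 2) t := fun t => by
    simpa using hasDerivAt_pow 3 t
  have hp2 : ∀ t : ℝ, HasDerivAt (fun s : ℝ => 3 * s ^ 2) (3 * (2 * t)) t := fun t => by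
    simpa using (hasDerivAt_pow 2 t).const_mul (3 : ℝ)
  have hφ1 : ∀ t : ℝ, 0 < t → HasDerivAt (fun s : ℝ => s ^ 3 * H₂ s) (3 * t ^ 2 * H₂ t + t ^ 3 * deriv H₂ t) t :=
    fun t ht => (hp3 t).mul (hd₂ t ht)
  have hφ1' : ∀ t : ℝ, 0 < t → deriv (fun s : ℝ => s ^ 3 * H₂ s) t = 3 * t ^ 2 * H₂ t + t ^ 3 * deriv H₂ t :=
    fun t ht => (hφ1 t ht).deriv
  have hφ2 : ∀ t : ℝ, 0 < t → HasDerivAt (fun s : ℝ => 3 * s ^ 2 * H₂ s + s ^ 3 * deriv H₂ s)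
      (t * (t ^ 2 * deriv (deriv H₂) t + 6 * t * deriv H₂ t + 6 * H₂ t)) t := fun t ht => by
    have h : HasDerivAt (fun s : ℝ => 3 * s ^ 2 * H₂ s + s ^ 3 * deriv H₂ s)
        (3 * (2 * t) * H₂ t + 3 * t ^ 2 * deriv H₂ t + (3 * t ^ 2 * deriv H₂ t + t ^ 3 * deriv (deriv H₂) t)) t :=
      ((hp2 t).mul (hd₂ t ht)).add ((hp3 t).mul (hd₂' t ht))
    exact h.congr_deriv (by ring)
  have hφ'' : ∀ t : ℝ, 0 < t → deriv (deriv (fun s : ℝ => s ^ 3 * H₂ s)) t = 0 := fun t ht => by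
    rw [deriv_eq_of_forall_pos hφ1' ht, (hφ2 t ht).deriv, hE t ht, mul_zero]
  obtain ⟨A, B, hAB⟩ := exists_affine_of_deriv_deriv_eq_zero (fun t ht => (hφ1 t ht).differentiableAt)
    (fun t ht => by
      have heq : deriv (fun s : ℝ => s ^ 3 * H₂ s) =ᶠ[𝓝 t] fun s : ℝ => 3 * s ^ 2 * H₂ s + s ^ 3 * deriv H₂ s := by
        filter_upwards [Ioi_mem_nhds ht] with s hs using hφ1' s hs
      exact (heq.differentiableAt_iff).2 (hφ2 t ht).differentiableAt) hφ''
  -- `A = 0` and `B = 0` from boundedness at `0⁺`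
  have hA : A = 0 := by
    have h3 := tendsto_pow_mul_profile hV₂ (n := 3) (by norm_num)
    have hlin : Tendsto (fun r : ℝ => A + B * r) (𝓝[>] (0 : ℝ)) (𝓝 (A + B * 0)) :=
      ((continuous_const.add (continuous_const.mul continuous_id)).continuousAt.tendsto).mono_left nhdsWithin_le_nhds
    rw [mul_zero, add_zero] at hlin
    have hlin' : Tendsto (fun r : ℝ => r ^ 3 * H₂ r) (𝓝[>] (0 : ℝ)) (𝓝 A) := by
      refine hlin.congr' ?_
      filter_upwards [self_mem_nhdsWithin] with s hs using (hAB s hs).symm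
    exact (tendsto_nhds_unique hlin' h3)
  have hB : B = 0 := by
    have h2 := tendsto_pow_mul_profile hV₂ (n := 2) (by norm_num)
    have hcst : Tendsto (fun r : ℝ => r ^ 2 * H₂ r) (𝓝[>] (0 : ℝ)) (𝓝 B) := by
      refine tendsto_const_nhds.congr' ?_
      filter_upwards [self_mem_nhdsWithin] with s hs
      have hs0 : (s : ℝ) ≠ 0 := ne_of_gt hs
      have := hAB s hs
      rw [hA, zero_add] at this
      -- `s³H₂ = Bs` ⇒ `s²H₂ = B`
      have : s * (s ^ 2 * H₂ s) = s * B := by linear_combination this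
      exact (mul_left_cancel₀ hs0 this).symm
    exact tendsto_nhds_unique hcst h2
  intro r hr
  have h0 := hAB r hr
  rw [hA, hB, zero_add, zero_mul] at h0
  rcases mul_eq_zero.1 h0 with h | h
  · exact absurd h (pow_ne_zero 3 hr.ne')
  · exact h

/-- ★ «QUAD-LAW ALTERNATIVE» (the real-analysis half of O2b «EQUATORIAL DICHOTOMY», CARD §5): for virial-admissible profiles `H₁`
(degree 1) and `H₂` (degree 2), analytic on `(0,∞)` and LINKED (`H₁K₂ = 3H₂K₁`), the quad law in Wronskian form
`(K₁′H₁ − K₁H₁′)·(H₁H₂ + r(H₁H₂′ − H₁′H₂)) ≡ 0` on `(0,∞)` (`= H₁⁴·V′·(rH₂/H₁)′`, `V = K₁/H₁`) forces: `H₁` is null, or `H₂` is null,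
or the profiles are HELMHOLTZ-LINKED (`K₁ = cH₁`, `K₂ = 3cH₂`). [folklore] -/
theorem quadLaw_alternative (hV₁ : VirialAdmissible 1 H₁) (hV₂ : VirialAdmissible 2 H₂)
    (hA₁ : AnalyticOnNhd ℝ H₁ (Ioi 0)) (hA₂ : AnalyticOnNhd ℝ H₂ (Ioi 0)) (hlink : IsLinked H₁ H₂)
    (hquad : ∀ r : ℝ, 0 < r →
      (deriv (vortAmpL 1 H₁) r * H₁ r - vortAmpL 1 H₁ r * deriv H₁ r) *
        (H₁ r * H₂ r + r * (H₁ r * deriv H₂ r - deriv H₁ r * H₂ r)) = 0) :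
    IsNullProfile H₁ ∨ IsNullProfile H₂ ∨ IsHelmholtzLinked H₁ H₂ := by
  by_cases h1z : ∀ r : ℝ, 0 < r → H₁ r = 0
  · exact Or.inl (isNullProfile_of_forall_pos hV₁ h1z)
  by_cases h2z : ∀ r : ℝ, 0 < r → H₂ r = 0
  · exact Or.inr (Or.inl (isNullProfile_of_forall_pos hV₂ h2z))
  have hK₁ : AnalyticOnNhd ℝ (vortAmpL 1 H₁) (Ioi 0) := analyticOnNhd_vortAmpL hA₁
  have hK₂ : AnalyticOnNhd ℝ (vortAmpL 2 H₂) (Ioi 0) := analyticOnNhd_vortAmpL hA₂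
  have hWa : AnalyticOnNhd ℝ (fun r => deriv (vortAmpL 1 H₁) r * H₁ r - vortAmpL 1 H₁ r * deriv H₁ r) (Ioi 0) :=
    fun r hr => ((hK₁.deriv r hr).mul (hA₁ r hr)).sub ((hK₁ r hr).mul (hA₁.deriv r hr))
  have hDa : AnalyticOnNhd ℝ (fun r => H₁ r * H₂ r + r * (H₁ r * deriv H₂ r - deriv H₁ r * H₂ r)) (Ioi 0) :=
    fun r hr => ((hA₁ r hr).mul (hA₂ r hr)).add
      (analyticAt_id.mul (((hA₁ r hr).mul (hA₂.deriv r hr)).sub ((hA₁.deriv r hr).mul (hA₂ r hr))))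
  rcases eqOn_zero_or_of_mul_eq_zero hWa hDa hquad with hW | hD
  · -- `W₁ ≡ 0`: `K₁ = cH₁`; linkage `H₁(K₂ − 3cH₂) ≡ 0` with `H₁ ≢ 0` gives `K₂ = 3cH₂`
    obtain ⟨c, hc⟩ := exists_eq_mul_of_wronskian_eq_zero hK₁ hA₁ hW h1z
    have hprod : ∀ s : ℝ, 0 < s → H₁ s * (vortAmpL 2 H₂ s - 3 * c * H₂ s) = 0 := fun s hs => by
      have := hlink s hs
      rw [hc s hs] at this
      linear_combination this
    have hFa : AnalyticOnNhd ℝ (fun s => vortAmpL 2 H₂ s - 3 * c * H₂ s) (Ioi 0) :=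
      fun s hs => (hK₂ s hs).sub (analyticAt_const.mul (hA₂ s hs))
    rcases eqOn_zero_or_of_mul_eq_zero hA₁ hFa hprod with h | h
    · exact absurd h h1z
    · exact Or.inr (Or.inr ⟨c, fun r hr => ⟨hc r hr, by linarith [h r hr]⟩⟩)
  · -- `D ≡ 0`: `D` is the Wronskian of `rH₂` and `H₁`, so `rH₂ = c′H₁`
    have hRa : AnalyticOnNhd ℝ (fun t : ℝ => t * H₂ t) (Ioi 0) := fun s hs => analyticAt_id.mul (hA₂ s hs)
    have hW' : ∀ r : ℝ, 0 < r → deriv (fun t : ℝ => t * H₂ t) r * H₁ r - r * H₂ r * deriv H₁ r = 0 :=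
      fun r hr => by rw [deriv_id_mul_profile hA₂ hr]; linear_combination hD r hr
    obtain ⟨c', hc'⟩ := exists_eq_mul_of_wronskian_eq_zero hRa hA₁ hW' h1z
    by_cases hc0 : c' = 0
    · refine Or.inr (Or.inl (isNullProfile_of_forall_pos hV₂ fun r hr => ?_))
      have := hc' r hr
      rw [hc0, zero_mul] at this
      rcases mul_eq_zero.1 this with h | h
      · exact absurd h hr.ne'
      · exact h
    · exact absurd (profile_eq_zero_of_proportional_of_linked hV₂ hA₂ hlink hc0 hc') h2z

end Alternative

end Summit.NavierStokesRegularity.NavierStokesRegularity.Theorems.UnthreadedRigidity.MixedPair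

end
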